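import Summits.CriticalPhenomena.PercolationContinuityZ3.Theses.PercNonProliferation
import Summits.CriticalPhenomena.PercolationContinuityZ3.Theses.PercQuarantineIslands
import Summits.CriticalPhenomena.PercolationContinuityZ3.Theorems.FreeBoxSparse.Negative.OfContinuity
import Literature.Probability.Percolation.UniquenessZone
import Literature.Probability.Percolation.BoxGatewayRarity

/-!
# STRATEGY CENSUS v2 — typed companion of the s1 additions (crux stmt-CriticalPhenomena-4445
# `PercNonProliferation.FreeBoxSparse`, strategist planner-cstrat-stmt-CriticalPhenomena-4445-s1-0, 2026-08-17)

Companion of `Cruxes/FreeBoxSparse/STRATEGY-CENSUS.md` v2 (sections marked "v2"). The v1 companion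
`Cruxes/FreeBoxSparse/StrategyCensus.lean` (strategist p1) stays authoritative for T1–T9, S1–S5, D1–D5, N-root.
Here: the new strengthenings S7 (subcritical thick slab), S9 (local connectivity decay), S10 (lacunary form),
the new split D9 (qualitative linear-aspect two-arm decay ∧ foam persistence) WITH ITS GLUE PROVED, and the
one-line sanity implications. Props + short proofs only; no `sorry`; nothing here is a stub of a line.

Notation: `Λ_n = box 3 n`, `μc = P_{p_c}` on `ℤ³` (bond), `fa2 n = FA₂(p_c, n)` (the crux is `fa2 → 0`).
-/

noncomputable section

open MeasureTheory Filter Topology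
open scoped Classical
open Literature.Probability.Percolation Literature.Probability.LatticeModels
open Summit.CriticalPhenomena.PercolationContinuityZ3.Theses.PercNonProliferation (FreeBoxSparse)
open Summit.CriticalPhenomena.PercolationContinuityZ3.Theses.PercQuarantineIslands (FiniteClusterVolumeTail)

namespace Summit.CriticalPhenomena.PercolationContinuityZ3.Cruxes.FreeBoxSparse.StrategyCensusS1

/-! ## §0 Vocabulary (as in the v1 companion) -/

abbrev V3 : Type := Site 3
abbrev μc : Measure (BondConfig V3) := bondPercolation (zdGraph 3) (criticalProbI 3)

/-- Free-box pair sum at `p_c`. -/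
def pairSum (n : ℕ) : ℝ := ∑ x ∈ box 3 n, ∑ y ∈ box 3 n, μc.real (openConnIn ↑(box 3 n) x y)

/-- `FA₂(p_c, n)`. -/
def fa2 (n : ℕ) : ℝ := pairSum n / ((box 3 n).card : ℝ) ^ 2

theorem freeBoxSparse_iff : FreeBoxSparse ↔ Tendsto fa2 atTop (𝓝 0) := Iff.rfl

theorem card_box_pos (n : ℕ) : (0 : ℝ) < (box 3 n).card := by
  exact_mod_cast Finset.card_pos.2 (box_nonempty 3 n)

theorem pairSum_nonneg (n : ℕ) : 0 ≤ pairSum n :=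
  Finset.sum_nonneg fun _ _ => Finset.sum_nonneg fun _ _ => measureReal_nonneg

theorem fa2_nonneg (n : ℕ) : 0 ≤ fa2 n := div_nonneg (pairSum_nonneg n) (sq_nonneg _)

/-! ## §S (v2) Strengthen -/

/-- The thick slab `S(n) = {z | |z₀| ≤ n} ⊇ Λ_n` (infinite in the two other directions). At `p = p_c(ℤ³)` it is
SUBCRITICAL for every `n` (Aizenman–Grimmett strict inequality `p_c(ℤ³) < p_c(S(n))` + slab sharpness), which is
the one rigorous "handle" the free box inherits from a solved regime. -/
def slab (n : ℕ) : Set V3 := {z | |z 0| ≤ (n : ℤ)}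

theorem box_subset_slab (n : ℕ) : (↑(box 3 n) : Set V3) ⊆ slab n := by
  intro z hz
  have hz' : z ∈ box 3 n := by exact_mod_cast hz
  exact abs_le.2 ((mem_box.1 hz') 0)

/-- **S7 (slab profile at the bulk critical point).** Uniformly over roots `x ∈ Λ_n`, the mass of the IN-SLAB cluster of
`x` inside `Λ_n` is `o(|Λ_n|)`: `Σ_{y∈Λ_n} P_{p_c}(x ↔ y inside S(n)) ≤ ψ(n)|Λ_n|`, `ψ → 0`. Implied by
"`χ_{S(2n+1)}(p_c(ℤ³)) = o(n³)` at the worst height" (subcritical slab susceptibility sub-extensive in the thickness);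
implies the crux (`s7_implies_crux`). Healthy-world value `ψ(n)|Λ_n| ≍ n^{2-η}·O(1) = n^{2.05}` (3D-critical mass up to
the thickness times an `O(1)` quasi-2D subcritical factor, since `p_c(S(k)) - p_c ≍ k^{-1/ν}` is exactly one rounding
width): true with room. No leverage: subcriticality of `S(n)` bounds the RANGE of in-slab connections (`ξ_{S(n)}(p_c) < ∞`,
plausibly `≍ n` in BOTH worlds), never the MASS below the range, which is the critical/deep in-box two-point function again. -/
def S7_SlabProfile : Prop :=
  ∃ ψ : ℕ → ℝ, Tendsto ψ atTop (𝓝 0) ∧ ∀ n : ℕ, ∀ x ∈ box 3 n,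
    (∑ y ∈ box 3 n, μc.real (openConnIn (slab n) x y)) ≤ ψ n * (box 3 n).card

/-- `S7 ⇒ crux` (in-box ⊆ in-slab, then average over the root). -/
theorem s7_implies_crux (h : S7_SlabProfile) : FreeBoxSparse := by
  obtain ⟨ψ, hψ, hb⟩ := h
  rw [freeBoxSparse_iff]
  have hle : ∀ n, fa2 n ≤ ψ n := by
    intro n
    have hN := card_box_pos n
    have hsum : pairSum n ≤ ψ n * (box 3 n).card * (box 3 n).card := by
      calc pairSum n ≤ ∑ x ∈ box 3 n, ψ n * (box 3 n).card := by
            refine Finset.sum_le_sum fun x hx => le_trans (Finset.sum_le_sum fun y _ => ?_) (hb n x hx)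
            exact measureReal_mono (openConnIn_mono (box_subset_slab n) x y)
        _ = ψ n * (box 3 n).card * (box 3 n).card := by
            rw [Finset.sum_const, nsmul_eq_mul]; ring
    rw [fa2, div_le_iff₀ (by positivity)]
    nlinarith [hsum]
  have hge : ∀ n, 0 ≤ fa2 n := fa2_nonneg
  exact squeeze_zero hge hle hψ

/-- **S8 (v2) = K alone.** The Kesten–Zhang-at-the-same-`p` crux K (stmt-0943, shared by four routes) now implies the crux
BY ITSELF: `subsurfaceBlocking` (`u_n ≥ e^{-εn²}` for every `ε`, landed) makes the `e^{-c m^{2/3}}` tail at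
`m = δ|Λ_n|` an `o(u_n)`, and c8's quarantine edge concludes — kernel-checked in the candidate proof of stmt-7076
attached to that item (`KestenZhangEdge.kestenZhangImpliesFreeBoxSparse_proof`). Typed here as the implication;
why no leverage: K's only known mechanism (GM/Pisztora blocks at the same `p`) is FALSE at `p_c` in every world
(all slabs are subcritical at `p_c`), so K at a percolating `p_c` is mechanism-less — morally the summit. -/
def S8_KGivesCrux : Prop := FiniteClusterVolumeTail → FreeBoxSparse

/-- **S9 (local connectivity decay, all aspect ratios).** For every `K`, two points at distance `m` are joined INSIDE the
box of radius `K m` around one of them with probability `→ 0` as `m → ∞`, uniformly over the sphere. `S9 ⇒ crux`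
(deep, `εn`-separated pairs carry all but an `O(ε)`-fraction of `FA₂`, and for them in-`Λ_n` ⊆ in-`Λ_{Km}(x)` with
`K = ⌈2/ε⌉`); the dead residual `stub_axisDecay` is its `K = 3` axis instance up to recentring. It is exactly
"the LOCAL part of `τ_{p_c}(0,v) → 0`" (the bulk statement being `≡ θ(p_c) = 0`): in the dust world it says the
chemical path between far points of `C∞` leaves every `K|v|`-ball w.h.p. (infinite tortuosity), in the foam world it
fails. No tool bounds tortuosity of a same-`p` infinite cluster from above or below without GM. -/
def S9_LocalConnectivityDecay : Prop :=
  ∀ K : ℕ, ∀ ε : ℝ, 0 < ε → ∀ᶠ m : ℕ in atTop, ∀ v : V3, (∃ i, (v i).natAbs = m) →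
    μc.real (openConnIn ↑(box 3 (K * m)) 0 v) ≤ ε

/-- **S10 (lacunary form) — an EQUIVALENT, not a strengthening.** Sparsity along ONE geometrically spaced sequence of
scales is the whole crux: `FA₂(m) ≤ (|Λ_N|/|Λ_m|)² FA₂(N) ≤ (2R)⁶ FA₂(N)` for `m ≤ N ≤ R m` (a pair joined inside
`Λ_m` is joined inside `Λ_N`). Closes the door "prove it only at convenient (dyadic, prime, MC-able) scales":
allowed, but each such scale is the full difficulty. `crux ⇒ S10` below; `S10 ⇒ crux` is the two-line monotonicity. -/
def S10_LacunarySparse : Prop :=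
  ∃ R : ℕ, ∃ N : ℕ → ℕ, Tendsto N atTop atTop ∧ (∀ j, N (j + 1) ≤ R * N j) ∧
    Tendsto (fun j => fa2 (N j)) atTop (𝓝 0)

theorem s10_of_crux (h : FreeBoxSparse) : S10_LacunarySparse := by
  refine ⟨2, fun j => j + 1, tendsto_add_atTop_nat 1, fun j => ?_,
    (freeBoxSparse_iff.1 h).comp (tendsto_add_atTop_nat 1)⟩
  show j + 1 + 1 ≤ 2 * (j + 1)
  omega

/-! ## §D (v2) Decomposition — the split by the two-arm scale, glue PROVED -/

/-- **D9-a (qualitative linear-aspect two-arm decay).** `sup_r P_{p_c}(A₂(r, K r)) → 0` as `K → ∞`: two DISTINCT clusters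
of `Λ_{Kr}` both joining `Λ_r` to `∂Λ_{Kr}` become unlikely at large but FIXED aspect ratio, uniformly in the inner
scale (`A₂ = (uniqZone r (K r))ᶜ`). Strictly weaker than v1's `D1_TwoArmRate` (no rate, so NOT the hegemony
hypothesis H∞, hence not known summit-strength); believed (ζ₂ ≈ 1.86); known only at polynomial aspect
`K = r^{κ-1}` (AKN 1987 / Cerf 2015, `AKN.dkt_prop1`). A genuinely open, genuinely weaker piece. -/
def D9_QualTwoArm : Prop :=
  ∀ ε : ℝ, 0 < ε → ∃ K : ℕ, 2 ≤ K ∧ ∀ᶠ r : ℕ in atTop, μc.real (uniqZone (d := 3) r (K * r))ᶜ ≤ ε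

/-- **D9-b (foam persistence).** In the counter-world the unglued adjacent giants (forced by the landed ceiling) stay in
DISTINCT pieces up to every bounded aspect ratio with probability bounded below: `¬crux ⇒ ∃ ε₁ > 0, ∀ K ≥ 2`,
frequently in `n`, `P(A₂(n, K n)) ≥ ε₁`. Implied by the crux (vacuously), so strictly on the weak side; with D9-a it
gives the crux (`crux_of_d9`). Why it is the crux in substance: a generic hierarchical foam HEALS geometrically in the
scale (ungluing at successive octaves roughly independent ⇒ `P(still distinct at aspect 2^j) ≈ ε₀^j`), which is
compatible with D9-a; so D9-b is false in the generic counter-world and proving it means excluding foam — i.e. the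
crux. Same failure shape as v1 D1 (fine vs macroscopic foam), one level up (healing vs persistent foam). -/
def D9_FoamPersistence : Prop :=
  ¬ FreeBoxSparse → ∃ ε₁ : ℝ, 0 < ε₁ ∧ ∀ K : ℕ, 2 ≤ K →
    ∃ᶠ n : ℕ in atTop, ε₁ ≤ μc.real (uniqZone (d := 3) n (K * n))ᶜ

/-- **Glue of D9 (kernel-checked): `D9-a → D9-b → crux`.** -/
theorem crux_of_d9 (ha : D9_QualTwoArm) (hb : D9_FoamPersistence) : FreeBoxSparse := by
  by_contra hS
  obtain ⟨ε₁, hε₁, hfreq⟩ := hb hS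
  obtain ⟨K, hK2, hev⟩ := ha (ε₁ / 2) (half_pos hε₁)
  obtain ⟨n, hn1, hn2⟩ := ((hfreq K hK2).and_eventually hev).exists
  linarith

/-! ## Sanity: the v2 strengthenings sit on the correct side -/

/-- The summit conjunct implies S8's consequent (irrefutability is inherited): `θ(p_c) = 0 ⇒ crux`, tree. -/
theorem crux_of_theta_eq_zero (hθ : theta (zdGraph 3) (0 : V3) (criticalProbI 3) = 0) : FreeBoxSparse :=
  Theorems.FreeBoxSparse.Negative.tendsto_freePairAverage_of_theta_eq_zero (criticalProbI 3) hθ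

end Summit.CriticalPhenomena.PercolationContinuityZ3.Cruxes.FreeBoxSparse.StrategyCensusS1

end
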